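import Literature.NumberTheory.LFunctions.VinogradovKorobov
import Mathlib.NumberTheory.LSeries.HurwitzZeta
import HarnessLib

/-!
# RH-FREE — Bellotti's explicit Richert bound for `ζ` and her Korobov–Vinogradov zero-free region («nothing here bears on the truth of RH»)

Topic `Literature/NumberTheory/LFunctions` (RH literature-typing tranche 1, L4 "explicit zero
statistics"). Label: **RH-FREE** — unconditional published theorems about `ζ`, vendored as NAMED
FACTS (`def … : Prop`, D-0014; nothing is asserted, users take `(h : …)`), plus the cheap PROVED
consequences that connect them to the tree's existing explicit inputs. Nothing here bears on the
truth of RH.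

Source: C. Bellotti, *Explicit bounds for the Riemann zeta function and a new zero-free region*,
J. Math. Anal. Appl. **536** (2024), no. 2, 128249 (arXiv:2306.10680v1; Zbl 1552.11100), typed from
the arXiv text `[corpus:paper:arxiv-2306.10680 p0003]` (Theorems 1.1–1.3 of §1):

* `Literature.NumberTheory.LFunctions.zeta_bound_bellotti` — **Theorem 1.1, first line**: for
  `|t| ≥ 3`, `1/2 ≤ σ ≤ 1`, `|ζ(σ + it)| ≤ A |t|^{B(1−σ)^{3/2}} log^{2/3}|t|` with `A = 70.6995`,
  `B = 4.43795` (Ford 2002: `A = 76.2`, `B = 4.45`, the tree's `zeta_bound_ford`).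
* `Literature.NumberTheory.LFunctions.hurwitzZeta_bound_bellotti` — **Theorem 1.1, second line**:
  the same bound for `|ζ(σ + it, u) − u^{−s}|`, `0 < u ≤ 1` (Hurwitz zeta function; Mathlib's
  `HurwitzZeta.hurwitzZeta u s = Σ_{n ≥ 0} (n + u)^{−s}`, `hasSum_hurwitzZeta_of_one_lt_re`).
* `Literature.NumberTheory.LFunctions.zero_free_region_bellotti` — **Theorem 1.2**: `ζ(σ + it) ≠ 0`
  for `|t| ≥ 3` and `σ ≥ 1 − 1/(53.989 (log|t|)^{2/3} (log log|t|)^{1/3})`. CONSTANT: the journal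
  version prints `53.989` (Zbl 1552.11100: "`C = 53.989` for every `|t| ≥ 3`"; Bellotti,
  arXiv:2311.05136, §1 footnote: "the value `54.004` in [arXiv:2306.10680] can be improved to `53.989`
  due to the improved [Littlewood-type region `σ ≥ 1 − log log|T|/(21.233 log|T|)`]"); the arXiv v1
  text reads `54.004`. The fact carries the journal constant; the arXiv-v1 statement is the PROVED
  corollary `zero_free_region_bellotti.arxiv_v1` (a narrower region).
* `Literature.NumberTheory.LFunctions.zero_free_region_bellotti_asymptotic` — **Theorem 1.3**: for
  `|t|` sufficiently large, no zeros with `σ ≥ 1 − 1/(48.0718 (log|t|)^{2/3} (log log|t|)^{1/3})`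
  (MTY 2024: `48.1588`).

Proved here (no new hypotheses):
* `zeta_bound_bellotti.zeta_bound_ford` — Theorem 1.1 implies the tree's named fact
  `Literature.NumberTheory.LFunctions.zeta_bound_ford` (`70.6995 ≤ 76.2`, `4.43795 ≤ 4.45`, `t ≥ 3 ≥ 1`);
* `zero_free_region_bellotti.vinogradov_korobov` — Theorem 1.2 implies the tree's **rh.S10**
  `Literature.NumberTheory.LFunctions.zero_free_region_vinogradov_korobov` (constant `55.241`,
  Mossinghoff–Trudgian–Yang 2024 Thm. 1.1), since `53.989 ≤ 55.241` and
  `(log|t|)^{2/3}(log log|t|)^{1/3} > 0` for `|t| ≥ 3` (`log 3 > 1`);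
* `zero_free_region_bellotti.arxiv_v1` — the arXiv-v1 form with `54.004`.

So a user holding Bellotti's two theorems needs neither Ford's bound nor MTY's Theorem 1.1 as
separate hypotheses. What is deliberately NOT here: the proofs (explicit Vinogradov mean value
theorem §§2–4, the zero-detector of §5 — each a theory of its own, cf. the `VinogradovKorobov*`
strand for MTY's constant), and Bellotti's intermediate lemmas.

## References

* C. Bellotti, J. Math. Anal. Appl. 536 (2024) 128249, Thms. 1.1–1.3 (arXiv:2306.10680v1;
  Zbl 1552.11100). [Bellotti2024]
* K. Ford, Proc. London Math. Soc. (3) 85 (2002) 565–633, Thm. 1. [Ford2002]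
* M. J. Mossinghoff, T. S. Trudgian, A. Yang, Res. Number Theory 10 (2024) no. 11, Thm. 1.1.
  [MossinghoffTrudgianYangRNT2024]
-/

noncomputable section

open Complex Real

namespace Literature.NumberTheory.LFunctions

/-! ## The named facts -/

/-- NAMED FACT (Bellotti 2024, Theorem 1.1, first line, as printed: "The following estimate holds
for every `|t| ≥ 3` and `1/2 ≤ σ ≤ 1`: `|ζ(σ + it)| ≤ A |t|^{B(1−σ)^{3/2}} log^{2/3}|t|` … with
`A = 70.6995` and `B = 4.43795`"). An explicit Richert-type bound (Richert 1967 `B = 100`; Cheng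
1999 `A = 175, B = 46`; Ford 2002 `A = 76.2, B = 4.45`). Unconditional. Users take
`(h : zeta_bound_bellotti)`. [cite: Bellotti2024, Thm. 1.1 (first line)] -/
def zeta_bound_bellotti : Prop :=
  ∀ σ t : ℝ, 3 ≤ |t| → 1 / 2 ≤ σ → σ ≤ 1 →
    ‖riemannZeta (σ + t * I)‖ ≤
      70.6995 * |t| ^ (4.43795 * (1 - σ) ^ (3 / 2 : ℝ)) * Real.log |t| ^ (2 / 3 : ℝ)

/-- NAMED FACT (Bellotti 2024, Theorem 1.1, second line, as printed: for every `|t| ≥ 3`,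
`1/2 ≤ σ ≤ 1` and `0 < u ≤ 1`, `|ζ(σ + it, u) − u^{−s}| ≤ A |t|^{B(1−σ)^{3/2}} log^{2/3}|t|`,
`A = 70.6995`, `B = 4.43795`, where `ζ(s, u) = Σ_{n ≥ 0} (n + u)^{−s}` is the Hurwitz zeta
function). In Lean `ζ(s, u)` is Mathlib's `HurwitzZeta.hurwitzZeta u s` (`u : ℝ` coerced to
`UnitAddCircle`; for `u ∈ [0, 1]` and `Re s > 1` it is `Σ_{n ≥ 0} (n + u)^{−s}`,
`HurwitzZeta.hasSum_hurwitzZeta_of_one_lt_re`), and `u^{−s}` is the principal complex power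
`(u : ℂ) ^ (−s)` (`u > 0` real). Unconditional. Users take `(h : hurwitzZeta_bound_bellotti)`.
[cite: Bellotti2024, Thm. 1.1 (second line)] -/
def hurwitzZeta_bound_bellotti : Prop :=
  ∀ σ t u : ℝ, 3 ≤ |t| → 1 / 2 ≤ σ → σ ≤ 1 → 0 < u → u ≤ 1 →
    ‖HurwitzZeta.hurwitzZeta (u : UnitAddCircle) (σ + t * I) - (u : ℂ) ^ (-(σ + t * I))‖ ≤
      70.6995 * |t| ^ (4.43795 * (1 - σ) ^ (3 / 2 : ℝ)) * Real.log |t| ^ (2 / 3 : ℝ)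

/-- NAMED FACT (Bellotti 2024, Theorem 1.2, Korobov–Vinogradov zero-free region with the journal
constant, as printed in J. Math. Anal. Appl. 536 (2024): "There are no zeros of `ζ(σ + it)` for
`|t| ≥ 3` and `σ ≥ 1 − 1/(53.989 (log|t|)^{2/3} (log log|t|)^{1/3})`"). The arXiv v1 text
(2306.10680v1, Thm. 1.2) has `54.004` in place of `53.989`; the improvement to `53.989` in the
published version uses Yang's explicit Littlewood region (Bellotti, arXiv:2311.05136, §1, footnote to
(1.5); Zbl 1552.11100). The v1 form is the proved corollary `zero_free_region_bellotti.arxiv_v1`.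
Same shape as the tree's `zero_free_region_vinogradov_korobov` (MTY 2024, `55.241`), which it
implies (`zero_free_region_bellotti.vinogradov_korobov`). Unconditional. Users take
`(h : zero_free_region_bellotti)`.
[cite: Bellotti2024, Thm. 1.2 (journal constant 53.989; arXiv v1: 54.004)] -/
def zero_free_region_bellotti : Prop :=
  ∀ σ t : ℝ, 3 ≤ |t| →
    1 - 1 / (53.989 * Real.log |t| ^ (2 / 3 : ℝ) * Real.log (Real.log |t|) ^ (1 / 3 : ℝ)) ≤ σ →
      riemannZeta (σ + t * I) ≠ 0

/-- NAMED FACT (Bellotti 2024, Theorem 1.3, as printed: "For sufficiently large `|t|`, there are no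
zeros of `ζ(σ + it)` with `σ ≥ 1 − 1/(48.0718 (log|t|)^{2/3} (log log|t|)^{1/3})`"), improving the
asymptotic constant `48.1588` of Mossinghoff–Trudgian–Yang 2024. "Sufficiently large" is rendered
as an (ineffective, as printed) threshold `T₀`. Unconditional. Users take
`(h : zero_free_region_bellotti_asymptotic)`. [cite: Bellotti2024, Thm. 1.3] -/
def zero_free_region_bellotti_asymptotic : Prop :=
  ∃ T₀ : ℝ, ∀ σ t : ℝ, T₀ ≤ |t| →
    1 - 1 / (48.0718 * Real.log |t| ^ (2 / 3 : ℝ) * Real.log (Real.log |t|) ^ (1 / 3 : ℝ)) ≤ σ →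
      riemannZeta (σ + t * I) ≠ 0

/-! ## Elementary consequences (proved) -/

/-- `log 3 > 1` (`exp 1 < 2.7182818286 < 3`). [folklore] -/
private theorem one_lt_log_three : 1 < Real.log 3 := by
  rw [Real.lt_log_iff_exp_lt (by norm_num)]
  have := Real.exp_one_lt_d9
  linarith

/-- For `|t| ≥ 3` the Korobov–Vinogradov denominator is positive:
`0 < (log|t|)^{2/3} (log log|t|)^{1/3}` (since `log|t| ≥ log 3 > 1`). [folklore] -/
private theorem vk_denominator_pos {t : ℝ} (ht : 3 ≤ |t|) :
    0 < Real.log |t| ^ (2 / 3 : ℝ) * Real.log (Real.log |t|) ^ (1 / 3 : ℝ) := by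
  have hL : 1 < Real.log |t| :=
    one_lt_log_three.trans_le (Real.log_le_log (by norm_num) ht)
  have hL0 : 0 < Real.log |t| := by linarith
  have hLL : 0 < Real.log (Real.log |t|) := Real.log_pos hL
  exact mul_pos (Real.rpow_pos_of_pos hL0 _) (Real.rpow_pos_of_pos hLL _)

/-- Monotonicity of Korobov–Vinogradov regions in the constant: for `|t| ≥ 3` and `0 < c ≤ c'`,
`1 − 1/(c P) ≤ 1 − 1/(c' P)` with `P = (log|t|)^{2/3}(log log|t|)^{1/3}`, so the region with the
smaller constant `c` is the wider one. [folklore] -/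
private theorem vk_threshold_mono {t c c' : ℝ} (ht : 3 ≤ |t|) (hc : 0 < c) (hcc' : c ≤ c') :
    1 - 1 / (c * Real.log |t| ^ (2 / 3 : ℝ) * Real.log (Real.log |t|) ^ (1 / 3 : ℝ)) ≤
      1 - 1 / (c' * Real.log |t| ^ (2 / 3 : ℝ) * Real.log (Real.log |t|) ^ (1 / 3 : ℝ)) := by
  have hP := vk_denominator_pos ht
  have h1 : 0 < c * Real.log |t| ^ (2 / 3 : ℝ) * Real.log (Real.log |t|) ^ (1 / 3 : ℝ) := by
    rw [mul_assoc]; exact mul_pos hc hP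
  have h2 : c * Real.log |t| ^ (2 / 3 : ℝ) * Real.log (Real.log |t|) ^ (1 / 3 : ℝ) ≤
      c' * Real.log |t| ^ (2 / 3 : ℝ) * Real.log (Real.log |t|) ^ (1 / 3 : ℝ) := by
    rw [mul_assoc, mul_assoc]; exact mul_le_mul_of_nonneg_right hcc' hP.le
  have := one_div_le_one_div_of_le h1 h2
  linarith

namespace zero_free_region_bellotti

/-- **Bellotti's Theorem 1.2 implies rh.S10** (the tree's `zero_free_region_vinogradov_korobov`,
Mossinghoff–Trudgian–Yang 2024, Thm. 1.1, constant `55.241`): the region with constant `53.989` is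
wider (`53.989 ≤ 55.241`, `vk_threshold_mono`). [cite: Bellotti2024, Thm. 1.2]
[cite: MossinghoffTrudgianYangRNT2024, Thm. 1.1] -/
theorem vinogradov_korobov (h : zero_free_region_bellotti) : zero_free_region_vinogradov_korobov := by
  intro σ t ht hσ
  exact h σ t ht ((vk_threshold_mono ht (by norm_num) (by norm_num : (53.989 : ℝ) ≤ 55.241)).trans hσ)

/-- **The arXiv-v1 form of Theorem 1.2** (arXiv:2306.10680v1: constant `54.004`): no zeros with
`|t| ≥ 3`, `σ ≥ 1 − 1/(54.004 (log|t|)^{2/3} (log log|t|)^{1/3})` — a narrower region than the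
journal's (`53.989 ≤ 54.004`). [cite: Bellotti2024, Thm. 1.2 (arXiv v1 constant 54.004)] -/
theorem arxiv_v1 (h : zero_free_region_bellotti) :
    ∀ σ t : ℝ, 3 ≤ |t| →
      1 - 1 / (54.004 * Real.log |t| ^ (2 / 3 : ℝ) * Real.log (Real.log |t|) ^ (1 / 3 : ℝ)) ≤ σ →
        riemannZeta (σ + t * I) ≠ 0 := by
  intro σ t ht hσ
  exact h σ t ht ((vk_threshold_mono ht (by norm_num) (by norm_num : (53.989 : ℝ) ≤ 54.004)).trans hσ)

/-- Positive-height reading: for real `t ≥ 3` and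
`σ ≥ 1 − 1/(53.989 (log t)^{2/3} (log log t)^{1/3})`, `ζ(σ + it) ≠ 0`. [cite: Bellotti2024, Thm. 1.2] -/
theorem of_pos (h : zero_free_region_bellotti) {σ t : ℝ} (ht : 3 ≤ t)
    (hσ : 1 - 1 / (53.989 * Real.log t ^ (2 / 3 : ℝ) * Real.log (Real.log t) ^ (1 / 3 : ℝ)) ≤ σ) :
    riemannZeta (σ + t * I) ≠ 0 := by
  have hta : |t| = t := abs_of_nonneg (by linarith)
  exact h σ t (by rw [hta]; exact ht) (by rw [hta]; exact hσ)

end zero_free_region_bellotti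

namespace zeta_bound_bellotti

/-- **Bellotti's Theorem 1.1 implies Ford's bound** in the form vendored in the tree
(`zeta_bound_ford`: `|ζ(σ + it)| ≤ 76.2 t^{4.45(1−σ)^{3/2}} (log t)^{2/3}` for `t ≥ 3`,
`1/2 ≤ σ ≤ 1`): `70.6995 ≤ 76.2`, and `t^{4.43795 e} ≤ t^{4.45 e}` for `t ≥ 1`, `e = (1−σ)^{3/2} ≥ 0`.
[cite: Bellotti2024, Thm. 1.1] [cite: Ford2002, Thm. 1] -/
theorem zeta_bound_ford (h : zeta_bound_bellotti) : zeta_bound_ford := by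
  intro σ t ht hσ hσ1
  have ht0 : 0 < t := by linarith
  have hta : |t| = t := abs_of_pos ht0
  have h1 := h σ t (by rw [hta]; exact ht) hσ hσ1
  rw [hta] at h1
  have he : 0 ≤ (1 - σ) ^ (3 / 2 : ℝ) := Real.rpow_nonneg (by linarith) _
  have hlog : 0 ≤ Real.log t := Real.log_nonneg (by linarith)
  have hL : 0 ≤ Real.log t ^ (2 / 3 : ℝ) := Real.rpow_nonneg hlog _
  have hpow : t ^ (4.43795 * (1 - σ) ^ (3 / 2 : ℝ)) ≤ t ^ (4.45 * (1 - σ) ^ (3 / 2 : ℝ)) :=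
    Real.rpow_le_rpow_of_exponent_le (by linarith) (by nlinarith)
  have hpos : 0 ≤ t ^ (4.43795 * (1 - σ) ^ (3 / 2 : ℝ)) := Real.rpow_nonneg ht0.le _
  calc ‖riemannZeta (σ + t * I)‖
      ≤ 70.6995 * t ^ (4.43795 * (1 - σ) ^ (3 / 2 : ℝ)) * Real.log t ^ (2 / 3 : ℝ) := h1
    _ ≤ 76.2 * t ^ (4.45 * (1 - σ) ^ (3 / 2 : ℝ)) * Real.log t ^ (2 / 3 : ℝ) := by
        gcongr
        · norm_num

/-- Two-sided form on `|t|`: for `|t| ≥ 3`, `1/2 ≤ σ ≤ 1`,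
`|ζ(σ + it)| ≤ 76.2 |t|^{4.45(1−σ)^{3/2}} (log|t|)^{2/3}` (Ford's constants, both signs of `t`).
[cite: Bellotti2024, Thm. 1.1] -/
theorem norm_zeta_le_ford_abs (h : zeta_bound_bellotti) {σ t : ℝ} (ht : 3 ≤ |t|) (hσ : 1 / 2 ≤ σ)
    (hσ1 : σ ≤ 1) :
    ‖riemannZeta (σ + t * I)‖ ≤ 76.2 * |t| ^ (4.45 * (1 - σ) ^ (3 / 2 : ℝ)) * Real.log |t| ^ (2 / 3 : ℝ) := by
  have h1 := h σ t ht hσ hσ1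
  have ht0 : 0 < |t| := by linarith
  have he : 0 ≤ (1 - σ) ^ (3 / 2 : ℝ) := Real.rpow_nonneg (by linarith) _
  have hlog : 0 ≤ Real.log |t| := Real.log_nonneg (by linarith)
  have hL : 0 ≤ Real.log |t| ^ (2 / 3 : ℝ) := Real.rpow_nonneg hlog _
  have hpow : |t| ^ (4.43795 * (1 - σ) ^ (3 / 2 : ℝ)) ≤ |t| ^ (4.45 * (1 - σ) ^ (3 / 2 : ℝ)) :=
    Real.rpow_le_rpow_of_exponent_le (by linarith) (by nlinarith)
  have hpos : 0 ≤ |t| ^ (4.43795 * (1 - σ) ^ (3 / 2 : ℝ)) := Real.rpow_nonneg ht0.le _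
  calc ‖riemannZeta (σ + t * I)‖
      ≤ 70.6995 * |t| ^ (4.43795 * (1 - σ) ^ (3 / 2 : ℝ)) * Real.log |t| ^ (2 / 3 : ℝ) := h1
    _ ≤ 76.2 * |t| ^ (4.45 * (1 - σ) ^ (3 / 2 : ℝ)) * Real.log |t| ^ (2 / 3 : ℝ) := by
        gcongr
        · norm_num

/-- On the `1`-line: for `|t| ≥ 3`, `|ζ(1 + it)| ≤ 70.6995 (log|t|)^{2/3}` (Theorem 1.1 at `σ = 1`,
where the power of `|t|` is `|t|⁰ = 1`). [cite: Bellotti2024, Thm. 1.1 (σ = 1)] -/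
theorem norm_zeta_one_line_le (h : zeta_bound_bellotti) {t : ℝ} (ht : 3 ≤ |t|) :
    ‖riemannZeta (1 + t * I)‖ ≤ 70.6995 * Real.log |t| ^ (2 / 3 : ℝ) := by
  have h1 := h 1 t ht (by norm_num) le_rfl
  have ht0 : 0 < |t| := by linarith
  have e0 : (4.43795 : ℝ) * (1 - 1) ^ (3 / 2 : ℝ) = 0 := by
    rw [sub_self, Real.zero_rpow (by norm_num)]; ring
  rw [e0, Real.rpow_zero, mul_one] at h1
  simpa using h1

end zeta_bound_bellotti

end Literature.NumberTheory.LFunctions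

end
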